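import Literature.MathematicalPhysics.QuantumFieldTheory.Balaban1983to89.B15Prop1DatumGaugeNormalisation
import Literature.MathematicalPhysics.QuantumFieldTheory.Balaban1983to89.B15Prop1AnalyticExtClause

/-!
# `Balaban1983to89.B15Prop1MinimiserFamilyGaugeCovariance` — [Balaban1989LargeFieldI] = «[IV]», p. 194, the sentence after (1.77): *«The function is invariant with respect to
# the group of all gauge transformations defined on Λ, hence it is natural to consider it on orbits of this group»*; [Balaban1989LargeFieldII] = «[LF-II]», p. 357 («the compensating
# adjoint gauge transformation on the variables B′»), p. 358 («holds for U₀ in an arbitrary gauge»); [Balaban1985Variational] = «[15]», (181) p. 307 («U_k(V^v) = U_k(V)^{v̄}»);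
# [Balaban1985BackgroundPropagators] (3.29) p. 395 («R(u) exp iηA = exp iηR(u)A R(u)»):
# ★★★ THE (J0′) CONCLUSION — THE HOLOMORPHIC BOUNDED FAMILY OF (2.12) MINIMISERS AROUND A BASE FIELD — IS GAUGE COVARIANT IN THE BASE FIELD

Honest framing: statement-level skeleton of published theorems with citation tags; proofs where landed; nothing here is a claim about the Yang–Mills mass gap.  Cell `pub-ymgap`
(HUMAN RULINGS D-0062 ∕ D-0149), lane `pub-ymgap-dag-n12-c` g27 (R134 seat (a), N12 = [B15], s1); count-neutral helper of K1⁹ `stmt-QuantumFields-27364` (`--kind proof --supports`);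
N12 NOT discharged; one finite 𝕋⁴ programme at fixed ε; nothing continuum ∕ ℝ⁴ ∕ OS ∕ mass-gap ∕ Clay.  THEOREMS ONLY (0 `def`, 0 `instance`, 0 `sorry`).

WHY (the lane's LOCATED-GAUGE-ORBIT, cell bus 2026-08-29, a located point on the lane's own «(J0′) OF RECORD» road).  The (J0′) letter of N12's knit reads, per instance and base
field `V_k` of the STRICT GUARD `PlaqSmallOn (plaqsInside (pts k (Z ∩ Λᶜ))) eR V_k` — a GAUGE-INVARIANT set of base fields —: «there is a family `Ũ(z)`, `z = (p, B′) ∈ (𝔤ᶜ)^{bonds}²`,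
holomorphic on `‖z‖ < R`, entrywise bounded by `𝓐₀`, whose real points are (2.12) minimisers for the data `M˙(Q_k^{s*}(e^{B′}·ext(e^{p}·V_k)))`» (the text below, `hMin`-body).  The
producers of record (`Summits/…/BalabanUVNodesN12MinimiserFamilyOfClass{ThresholdUniform, DatumLettersUniform}`) deliver it from per-base-field rows — the gauge row (δ) on the minimiser,
resp. the datum letter `∀ c ∈ 𝒞, dist1 ((ext V_k) c) ≤ ρn` — which are NOT gauge invariant: on the level-`0`-pinned bonds they read the datum's own bond variables, so at the pure gauge
`V_k′ := 1^g`, `g(y₁) = −1` at one `k`-site under `∂Ω₁(Z)`, they fail (`dist1 = 2`) although `V_k′` lies in every guard.  Asked for EVERY base field of the guard (the knit-side junctions'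
`hbase`), those rows are unsatisfiable.  PRINT's remedy is the sentence of p. 194: normalise the datum on its gauge orbit first.  THIS FILE supplies the kernel fact that makes the remedy
available to the (J0′) road: the `hMin`-body is COVARIANT along the orbit — if it holds at `W` with `(R, 𝓐)` it holds at `W^u` with `(R∕3, 4𝓐)` for every gauge transformation `u` of
`T^{(k)}` commuting with the extension (`ext (X^u) = (ext X)^u`; for print's p. 193 extension this is dag-n12-w6's `B15Prop1DatumGaugeNormalisation.extend_gaugeAct_of_eq_one`: `u = 1` on
`Λ^{(k)}` and at the corner).  So the rows need only be fed on a NORMALISED slice of the guard (w6's normalising gauge (A) `exists_gauge_normalising_extend` carries every base field into it),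
and the conclusion returns along the orbit; `R`, `𝓐₀` are per-instance binders of the knit, so nothing upstream changes.

MECHANISM ([LF-II] p. 357; [B-Prop] (3.29); [15] (181)).  `e^{p}·W^u = (e^{p̃}·W)^u` with the compensating rotation `p̃_b = Ad_{u(b₋)⁻¹} p_b` (w6's
`expMul_gaugeAct_eq_gaugeAct_expMul_ad`), twice; `Q_k^{s*}(Y^u) = (Q_k^{s*}Y)^{ū}` with the block lift `ū` (r11's `B15Eq177GaugeInvariance.qsstarGIter0_gaugeAct`); `M^j(U^{ū}) = (M^j U)^{ū↾}`
(r13's `iter_gaugeAct`); minimisers of `ū`-related data correspond under `U ↦ U^{ū}` (r11's `B15Eq177ValueInvariance.isMinimizer_gaugeAct_of_related`, class gauge invariant).  The family is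
transported by `Ũ′(z)(b) := ū(b₋)·Ũ(ρz)(b)·ū(b₊)⁻¹` with `ρ` the bondwise COMPLEXIFIED adjoint rotation (§1: a `ℂ`-linear map of `ℂ³` agreeing with `Ad` on real vectors, norm `≤ 3` in the
crude bound), so `ρ` maps the ball of radius `R∕3` into the ball of radius `R` (holomorphy by composition) and unitary conjugation costs a factor `4` on matrix entries (§2).

CONTENTS.  §1 `exists_adSU2C` · §2 `norm_conj_entry_le` · §3 ★★★ `hMinBody_gaugeAct` (generic lattice, averaging family, gauge-invariant class, determining set in the standing range,
extension commuting with `u`) · §4 ★★★ `hMinBody_gaugeAct_atRecord` (NODE 00's `avOfRecord F 2 Kt`, `regMSCoPOfRecord F 2 ν Kt k (maxDomT ν.M₁ Z)`, `Bj ν.M₁ Z k`, print's extension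
`extend (castSite '' [lo, hi]) (shellGauge · lo hi)`, `u = 1` on the box and at its corner), `gaugeAct_invG_gaugeAct`, ★★★ `hMinBody_of_gaugeAct_normalised` (RETURN ALONG THE ORBIT: the body at
the normalised representative `V^{ũ}` gives the body at `V`) · §5 `gaugeAct_one_apply`, `plaqSmallOn_gaugeAct_one`, ★ `dist1_le_of_forall_pureGauge_datumLetter` (the kernel certificate of the
witness: a datum letter on a bond the extension does not touch, asked of every pure gauge — all of which lie in every plaquette guard —, forces its tolerance above `dist1 h` for EVERY `h`).
HONEST SCOPE: group bookkeeping + finite-dimensional calculus over landed theorems; nothing of Bałaban's estimates asserted; count-neutral; N12 NOT discharged; K1⁹ NOT closed; R4 closes only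
the conditional finite-𝕋⁴ rung `BalabanLadder.UV` — no summit statement is proved here and NOT the Yang–Mills mass gap (Clay); nothing continuum ∕ ℝ⁴ ∕ OS.
-/

noncomputable section

open Set Metric
open scoped Matrix.Norms.L2Operator InnerProductSpace

namespace Literature.MathematicalPhysics.QuantumFieldTheory.Balaban1983to89.B15Prop1MinimiserFamilyGaugeCovariance

open GaugeField B15DeterminingSets B16Sect1Backgrounds T4Continuum
open B15Prop1ChartSU2 (su2Chart adSU2)
open B15Prop1ChartCalculusSU2 (E3)
open B15Prop1DatumGaugeNormalisation (norm_adSU2_eq expMul_gaugeAct_eq_gaugeAct_expMul_ad extend_gaugeAct_of_eq_one)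
open B15Prop1AnalyticExtClause (cplxVec)
open B15Eq177GaugeInvariance (blockLift qsstarGIter0_gaugeAct)
open B15Eq177ValueInvariance (isMinimizer_gaugeAct_of_related)
open Literature.MathematicalPhysics.QuantumFieldTheory.BalabanImbrieJaffe1984to88.BIJ85Eq453GaugeField (qsstarGIter0)
open T4CubeChartGnomonic (SU2)

/-! ## §1  The complexified adjoint rotation of `ℂ³` -/

section AdC

/-- **THE COMPENSATING ADJOINT ROTATION ON THE COMPLEXIFIED PARAMETERS** ([LF-II] p. 357 «the compensating adjoint gauge transformation on the variables B′», `B′ ∈ 𝔤ᶜ`): for `h ∈ SU(2)`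
there is a `ℂ`-linear continuous map `L` of `ℂ³` which agrees with `Ad_h` on real vectors (`L(ιx) = ι(Ad_h x)`, `ι` the coordinatewise inclusion `ℝ³ ⊂ ℂ³`) and has norm at most `3`
(crude entrywise bound: the columns `Ad_h e_b` are unit vectors). [cite: Balaban1989LargeFieldII, p.357; Balaban1985BackgroundPropagators, (3.29) p.395] -/
theorem exists_adSU2C (h : SU2) : ∃ L : EuclideanSpace ℂ (Fin 3) →L[ℂ] EuclideanSpace ℂ (Fin 3),
    (∀ x : EuclideanSpace ℝ (Fin 3), L (WithLp.toLp 2 fun a => ((x a : ℝ) : ℂ)) = WithLp.toLp 2 fun a => ((adSU2 h x a : ℝ) : ℂ)) ∧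
      ∀ v, ‖L v‖ ≤ 3 * ‖v‖ := by
  classical
  -- the images of the basis vectors, complexified
  let C : Fin 3 → EuclideanSpace ℂ (Fin 3) := fun b => WithLp.toLp 2 fun a => ((adSU2 h (EuclideanSpace.single b (1 : ℝ)) a : ℝ) : ℂ)
  let L : EuclideanSpace ℂ (Fin 3) →L[ℂ] EuclideanSpace ℂ (Fin 3) := ∑ b, (EuclideanSpace.proj b).smulRight (C b)
  have hL : ∀ v : EuclideanSpace ℂ (Fin 3), L v = ∑ b, v b • C b := fun v => by
    simp only [L, FunLike.coe_sum, Finset.sum_apply, ContinuousLinearMap.smulRight_apply, PiLp.proj_apply]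
  have hC : ∀ b, ‖C b‖ = 1 := fun b => by
    have h1 : ‖C b‖ = ‖adSU2 h (EuclideanSpace.single b (1 : ℝ))‖ := by
      rw [EuclideanSpace.norm_eq, EuclideanSpace.norm_eq]
      congr 1
      refine Finset.sum_congr rfl fun a _ => ?_
      simp [C]
    rw [h1, norm_adSU2_eq, PiLp.norm_single, norm_one]
  refine ⟨L, fun x => ?_, fun v => ?_⟩
  · -- real vectors: expand `x` in the standard basis
    rw [hL]
    have hx : adSU2 h x = ∑ b, x b • adSU2 h (EuclideanSpace.single b (1 : ℝ)) := by
      conv_lhs => rw [← (EuclideanSpace.basisFun (Fin 3) ℝ).sum_repr x]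
      simp only [map_sum, map_smul, EuclideanSpace.basisFun_apply, EuclideanSpace.basisFun_repr]
    ext a
    simp only [C, hx]
    simp [WithLp.ofLp_sum, Finset.sum_apply]
  · rw [hL]
    calc ‖∑ b, v b • C b‖ ≤ ∑ b, ‖v b • C b‖ := norm_sum_le _ _
      _ = ∑ b : Fin 3, ‖v b‖ := by
          refine Finset.sum_congr rfl fun b _ => ?_
          rw [norm_smul, hC, mul_one]
      _ ≤ ∑ _b : Fin 3, ‖v‖ := Finset.sum_le_sum fun b _ => PiLp.norm_apply_le v b
      _ = 3 * ‖v‖ := by simp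

end AdC

/-! ## §2  Unitary conjugation on matrix entries -/

section Entries

/-- **UNITARY CONJUGATION COSTS A FACTOR `4` ON THE ENTRIES OF A `2 × 2` MATRIX**: `|(A·M·C)_{ij}| ≤ 4𝓐` for unitary `A`, `C` and `|M_{kl}| ≤ 𝓐` (entries of a unitary are `≤ 1`,
Mathlib's `entry_norm_bound_of_unitary`; four terms). [cite: Balaban1985BackgroundPropagators, (3.29) p.395 (bookkeeping)] -/
theorem norm_conj_entry_le {A C M : Matrix (Fin 2) (Fin 2) ℂ} (hA : A ∈ Matrix.unitaryGroup (Fin 2) ℂ) (hC : C ∈ Matrix.unitaryGroup (Fin 2) ℂ)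
    {𝓐 : ℝ} (hM : ∀ i j, ‖M i j‖ ≤ 𝓐) (i j : Fin 2) : ‖(A * M * C) i j‖ ≤ 4 * 𝓐 := by
  have h𝓐 : 0 ≤ 𝓐 := (norm_nonneg _).trans (hM 0 0)
  rw [Matrix.mul_apply]
  calc ‖∑ l, (A * M) i l * C l j‖ ≤ ∑ l, ‖(A * M) i l * C l j‖ := norm_sum_le _ _
    _ ≤ ∑ _l : Fin 2, 2 * 𝓐 := Finset.sum_le_sum fun l _ => ?_
    _ = 4 * 𝓐 := by simp only [Finset.sum_const, Finset.card_univ, Fintype.card_fin]; ring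
  rw [norm_mul, Matrix.mul_apply]
  have h1 : ‖∑ k, A i k * M k l‖ ≤ 2 * 𝓐 :=
    calc ‖∑ k, A i k * M k l‖ ≤ ∑ k, ‖A i k * M k l‖ := norm_sum_le _ _
      _ ≤ ∑ _k : Fin 2, 𝓐 := Finset.sum_le_sum fun k _ => by
          rw [norm_mul]
          calc ‖A i k‖ * ‖M k l‖ ≤ 1 * 𝓐 :=
                mul_le_mul (entry_norm_bound_of_unitary hA i k) (hM k l) (norm_nonneg _) zero_le_one
            _ = 𝓐 := one_mul _
      _ = 2 * 𝓐 := by simp only [Finset.sum_const, Finset.card_univ, Fintype.card_fin]; ring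
  calc ‖∑ k, A i k * M k l‖ * ‖C l j‖ ≤ 2 * 𝓐 * 1 :=
        mul_le_mul h1 (entry_norm_bound_of_unitary hC l j) (norm_nonneg _) (by positivity)
    _ = 2 * 𝓐 := mul_one _

end Entries

/-! ## §3  ★★★ The (J0′) conclusion is gauge covariant in the base field -/

section Covariance

variable {P : Params} {k : ℕ}

/-- The compensated rotation of a real perturbation does not increase its (sup) norm: `‖(Ad_{u(·₋)⁻¹} p)‖ ≤ ‖p‖` (`Ad` is an isometry of `ℝ³` bondwise). [cite: Balaban1989LargeFieldII, p.357 (bookkeeping)] -/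
theorem norm_ad_le (u : GaugeTransf P k SU2) (p : VecField P k E3) : ‖(fun b => adSU2 (u b.src)⁻¹ (p b) : VecField P k E3)‖ ≤ ‖p‖ :=
  (pi_norm_le_iff_of_nonneg (norm_nonneg p)).2 fun b => (norm_adSU2_eq _ _).le.trans (norm_le_pi_norm p b)

/-- ★★★ **THE (J0′) CONCLUSION IS GAUGE COVARIANT IN THE BASE FIELD** (generic lattice `P`, averaging family `av`, a GAUGE-INVARIANT class `reg`, a determining set `𝔹` void above the
standing range, a level `k ≤ m + K`, an extension `ext` COMMUTING with the gauge transformation `u` of `T^{(k)}`).  If the `hMin`-body holds at the base field `W` with radius `R` and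
entry bound `𝓐` — a family `Ũ(z)` holomorphic on `‖z‖ < R`, `|Ũ(z)_b,ij| ≤ 𝓐`, whose real points `(p, B′)` are (2.12) minimisers for the data `M˙(Q_k^{s*}(e^{B′}·ext(e^{p}·W)))` — then it
holds at `W^u` with radius `R∕3` and bound `4𝓐`: the transported family is `z ↦ ū(b₋)·Ũ(ρz)(b)·ū(b₊)⁻¹`, `ρ` the bondwise complexified rotation `Ad_{u(b₋)⁻¹}` (§1), `ū = blockLift k u`.
[cite: Balaban1989LargeFieldI, p.194 (sentence after (1.77)); Balaban1989LargeFieldII, p.357, p.358; Balaban1985Variational, (181) p.307; Balaban1985BackgroundPropagators, (3.29) p.395; Balaban1988Convergent, (2.12) p.256] -/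
theorem hMinBody_gaugeAct (av : ∀ j, Averaging P j SU2) {reg : Set (GaugeField P 0 SU2)}
    (hreg : ∀ (w : GaugeTransf P 0 SU2) (U : GaugeField P 0 SU2), U ∈ reg → gaugeAct w U ∈ reg)
    {𝔹 : DetSet P} (h𝔹 : ∀ j, P.m + P.K < j → 𝔹 j = ∅) (hk : k ≤ P.m + P.K)
    (ext : GaugeField P k SU2 → GaugeField P k SU2) (u : GaugeTransf P k SU2) (hext : ∀ X : GaugeField P k SU2, ext (gaugeAct u X) = gaugeAct u (ext X))
    (W : GaugeField P k SU2) {R 𝓐 : ℝ}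
    (h : ∃ Ũ : VecField P k (EuclideanSpace ℂ (Fin 3)) × VecField P k (EuclideanSpace ℂ (Fin 3)) → PBond P 0 → Matrix (Fin 2) (Fin 2) ℂ,
      (∀ b i j, DifferentiableOn ℂ (fun z => Ũ z b i j) (ball 0 R)) ∧
      (∀ z ∈ ball (0 : VecField P k (EuclideanSpace ℂ (Fin 3)) × VecField P k (EuclideanSpace ℂ (Fin 3))) R, ∀ b i j, ‖Ũ z b i j‖ ≤ 𝓐) ∧
      ∀ p B' : VecField P k E3, ‖p‖ < R → ‖B'‖ < R → ∃ U' : GaugeField P 0 SU2,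
        (∀ b, Ũ (cplxVec p, cplxVec B') b = ((U' b : SU2) : Matrix (Fin 2) (Fin 2) ℂ)) ∧
          IsMinimizer av reg 𝔹 (avgFamily av (qsstarGIter0 k (expMul su2Chart B' (ext (expMul su2Chart p W))))) U') :
    ∃ Ũ : VecField P k (EuclideanSpace ℂ (Fin 3)) × VecField P k (EuclideanSpace ℂ (Fin 3)) → PBond P 0 → Matrix (Fin 2) (Fin 2) ℂ,
      (∀ b i j, DifferentiableOn ℂ (fun z => Ũ z b i j) (ball 0 (R / 3))) ∧
      (∀ z ∈ ball (0 : VecField P k (EuclideanSpace ℂ (Fin 3)) × VecField P k (EuclideanSpace ℂ (Fin 3))) (R / 3), ∀ b i j, ‖Ũ z b i j‖ ≤ 4 * 𝓐) ∧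
      ∀ p B' : VecField P k E3, ‖p‖ < R / 3 → ‖B'‖ < R / 3 → ∃ U' : GaugeField P 0 SU2,
        (∀ b, Ũ (cplxVec p, cplxVec B') b = ((U' b : SU2) : Matrix (Fin 2) (Fin 2) ℂ)) ∧
          IsMinimizer av reg 𝔹 (avgFamily av (qsstarGIter0 k (expMul su2Chart B' (ext (expMul su2Chart p (gaugeAct u W)))))) U' := by
  classical
  obtain ⟨Ũ, hhol, hbd, hreal⟩ := h
  -- §1 bondwise: the complexified rotations `Ad_{u(b₋)⁻¹}`
  choose L hLre hLnorm using fun b : PBond P k => exists_adSU2C (u b.src)⁻¹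
  -- the parameter map `ρ`
  let Φ : VecField P k (EuclideanSpace ℂ (Fin 3)) →L[ℂ] VecField P k (EuclideanSpace ℂ (Fin 3)) :=
    ContinuousLinearMap.pi fun b => (L b).comp (ContinuousLinearMap.proj b)
  let ρ : (VecField P k (EuclideanSpace ℂ (Fin 3)) × VecField P k (EuclideanSpace ℂ (Fin 3))) →L[ℂ]
      (VecField P k (EuclideanSpace ℂ (Fin 3)) × VecField P k (EuclideanSpace ℂ (Fin 3))) :=
    (Φ.comp (ContinuousLinearMap.fst ℂ _ _)).prod (Φ.comp (ContinuousLinearMap.snd ℂ _ _))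
  have hΦ : ∀ x b, Φ x b = L b (x b) := fun x b => rfl
  have hΦn : ∀ x, ‖Φ x‖ ≤ 3 * ‖x‖ := fun x =>
    (pi_norm_le_iff_of_nonneg (by positivity)).2 fun b =>
      (hΦ x b ▸ hLnorm b (x b)).trans (mul_le_mul_of_nonneg_left (norm_le_pi_norm x b) (by norm_num))
  have hρ : ∀ z, ρ z = (Φ z.1, Φ z.2) := fun z => rfl
  have hρn : ∀ z, ‖ρ z‖ ≤ 3 * ‖z‖ := fun z => by
    rw [hρ, Prod.norm_def]
    exact max_le ((hΦn z.1).trans (mul_le_mul_of_nonneg_left (norm_fst_le z) (by norm_num)))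
      ((hΦn z.2).trans (mul_le_mul_of_nonneg_left (norm_snd_le z) (by norm_num)))
  have hmaps : MapsTo ρ (ball 0 (R / 3)) (ball 0 R) := fun z hz => by
    rw [mem_ball_zero_iff] at hz ⊢
    have := hρn z
    linarith
  -- on real parameters `ρ` is the compensated rotation
  have hρre : ∀ p B' : VecField P k E3,
      ρ (cplxVec p, cplxVec B') = (cplxVec (fun b => adSU2 (u b.src)⁻¹ (p b)), cplxVec (fun b => adSU2 (u b.src)⁻¹ (B' b))) := by
    intro p B'
    rw [hρ]
    refine Prod.ext (funext fun b => ?_) (funext fun b => ?_)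
    · exact hLre b (p b)
    · exact hLre b (B' b)
  -- the lifted fine gauge and the transported family
  refine ⟨fun z b => ((blockLift k u b.src : SU2) : Matrix (Fin 2) (Fin 2) ℂ) * Ũ (ρ z) b * (((blockLift k u b.tgt)⁻¹ : SU2) : Matrix (Fin 2) (Fin 2) ℂ),
    fun b i j => ?_, fun z hz b i j => ?_, fun p B' hp hB' => ?_⟩
  · -- holomorphy: entries are finite sums of constants times entries of `Ũ ∘ ρ`
    have hcomp : ∀ k' l, DifferentiableOn ℂ (fun z => Ũ (ρ z) b k' l) (ball 0 (R / 3)) := fun k' l =>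
      (hhol b k' l).comp ρ.differentiable.differentiableOn hmaps
    have hfun : (fun z => (((blockLift k u b.src : SU2) : Matrix (Fin 2) (Fin 2) ℂ) * Ũ (ρ z) b *
          (((blockLift k u b.tgt)⁻¹ : SU2) : Matrix (Fin 2) (Fin 2) ℂ)) i j) =
        fun z => ∑ l, (∑ k', ((blockLift k u b.src : SU2) : Matrix (Fin 2) (Fin 2) ℂ) i k' * Ũ (ρ z) b k' l) *
          (((blockLift k u b.tgt)⁻¹ : SU2) : Matrix (Fin 2) (Fin 2) ℂ) l j := by
      funext z; simp only [Matrix.mul_apply]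
    rw [hfun]
    exact DifferentiableOn.fun_sum fun l _ => (DifferentiableOn.fun_sum fun k' _ => (hcomp k' l).const_mul _).mul_const _
  · -- the entry bound
    exact norm_conj_entry_le (Matrix.mem_specialUnitaryGroup_iff.1 (blockLift k u b.src).2).1
      (Matrix.mem_specialUnitaryGroup_iff.1 ((blockLift k u b.tgt)⁻¹).2).1 (fun i' j' => hbd (ρ z) (hmaps hz) b i' j') i j
  · -- real points: the compensated parameters, the minimiser of the rotated data, its transport by `ū`
    have hR3 : R / 3 ≤ R := by
      have : 0 < R := by
        have h0 := norm_nonneg p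
        linarith
      linarith
    obtain ⟨U', hU'eq, hU'min⟩ := hreal (fun b => adSU2 (u b.src)⁻¹ (p b)) (fun b => adSU2 (u b.src)⁻¹ (B' b))
      ((norm_ad_le u p).trans_lt (hp.trans_le hR3)) ((norm_ad_le u B').trans_lt (hB'.trans_le hR3))
    refine ⟨gaugeAct (blockLift k u) U', fun b => ?_, ?_⟩
    · show ((blockLift k u b.src : SU2) : Matrix (Fin 2) (Fin 2) ℂ) * Ũ (ρ (cplxVec p, cplxVec B')) b *
          (((blockLift k u b.tgt)⁻¹ : SU2) : Matrix (Fin 2) (Fin 2) ℂ) = ((gaugeAct (blockLift k u) U' b : SU2) : Matrix (Fin 2) (Fin 2) ℂ)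
      rw [hρre, hU'eq b]
      simp only [gaugeAct, Submonoid.coe_mul]
    · have hY : expMul su2Chart B' (ext (expMul su2Chart p (gaugeAct u W))) =
          gaugeAct u (expMul su2Chart (fun b => adSU2 (u b.src)⁻¹ (B' b)) (ext (expMul su2Chart (fun b => adSU2 (u b.src)⁻¹ (p b)) W))) := by
        rw [expMul_gaugeAct_eq_gaugeAct_expMul_ad u p W, hext, expMul_gaugeAct_eq_gaugeAct_expMul_ad u B']
      rw [hY, qsstarGIter0_gaugeAct k hk u]
      exact isMinimizer_gaugeAct_of_related av hreg h𝔹 (blockLift k u)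
        (V := avgFamily av (qsstarGIter0 k (expMul su2Chart (fun b => adSU2 (u b.src)⁻¹ (B' b))
          (ext (expMul su2Chart (fun b => adSU2 (u b.src)⁻¹ (p b)) W)))))
        (fun j hj => iter_gaugeAct av (blockLift k u) _ j hj) hU'min

end Covariance

/-! ## §4  ★★★ At NODE 00's objects: the class of record, `𝐁_k(Z)`, print's p. 193 extension, a gauge fixing the box and its corner -/

section AtRecord

open B14.Eq213DetSet (Bj maxDomT Bj_of_gt)
open T4AxialGaugeSmallField (castSite)
open B15Extension193 (extend)
open B15ShellGauge193 (shellGauge)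
open B15Eq177ValueInvarianceCoDiv (gaugeAct_mem_regMSCoPOfRecord)

/-- ★★★ **THE (J0′) CONCLUSION OF RECORD IS GAUGE COVARIANT IN THE BASE FIELD** — §3 at NODE 00's averaging `M˙`, the (2.12) class of record `U_k({Ω_j(Z)}, εreg)` (gauge invariant:
`B15Eq177ValueInvarianceCoDiv.gaugeAct_mem_regMSCoPOfRecord`), the determining set `𝐁_k(Z)` (void above level `k ≤ m + K`), and print's p. 193 extension
`ext V = extend (castSite '' [lo, hi]) (shellGauge V lo hi) V` — for EVERY gauge transformation `u` of `T^{(k)}` equal to `1` on the box `castSite '' [lo, hi]` and at its corner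
`castSite (lo − 1)` (dag-n12-w6's `extend_gaugeAct_of_eq_one`: the extension commutes with such `u`): the `hMin`-body at `W` with `(R, 𝓐)` gives the `hMin`-body at `W^u` with `(R∕3, 4𝓐)` —
the text of U2 ∕ U3's conclusion and of the knit's `hMin` row, VERBATIM in shape.  USE: feed the producers' per-base-field rows on a NORMALISED representative `W := V_k^{u⁻¹}` (w6's
`exists_gauge_normalising_extend`) and return to `V_k` along the orbit. [cite: Balaban1989LargeFieldI, p.193, p.194 (sentence after (1.77)); Balaban1989LargeFieldII, p.357, p.358, (1.12)–(1.13) p.359; Balaban1985Variational, (2) p.278, (181) p.307; Balaban1988Convergent, (2.12)–(2.13) pp.256–257] -/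
theorem hMinBody_gaugeAct_atRecord {F : T4Family} (ν : Node00.Stage7Numerics) (Kt : ℕ) {k : ℕ} (hk : k ≤ (F.P Kt).m + (F.P Kt).K)
    (Z : Set (Site (F.P Kt) 0)) {lo hi : Fin (F.P Kt).d → ℤ} (hN : ∀ κ, hi κ - lo κ + 3 < ((F.P Kt).sitesPerDir k : ℤ))
    (ext : GaugeField (F.P Kt) k SU2 → GaugeField (F.P Kt) k SU2)
    (hext : ∀ V, ext V = extend (castSite '' Set.Icc lo hi : Set (Site (F.P Kt) k)) (shellGauge V lo hi) V)
    (u : GaugeTransf (F.P Kt) k SU2) (hu : ∀ s ∈ (castSite '' Set.Icc lo hi : Set (Site (F.P Kt) k)), u s = 1) (hu₀ : u (castSite (lo - 1)) = 1)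
    (W : GaugeField (F.P Kt) k SU2) {R 𝓐 : ℝ}
    (h : ∃ Ũ : VecField (F.P Kt) k (EuclideanSpace ℂ (Fin 3)) × VecField (F.P Kt) k (EuclideanSpace ℂ (Fin 3)) → PBond (F.P Kt) 0 → Matrix (Fin 2) (Fin 2) ℂ,
      (∀ b i j, DifferentiableOn ℂ (fun z => Ũ z b i j) (ball 0 R)) ∧
      (∀ z ∈ ball (0 : VecField (F.P Kt) k (EuclideanSpace ℂ (Fin 3)) × VecField (F.P Kt) k (EuclideanSpace ℂ (Fin 3))) R, ∀ b i j, ‖Ũ z b i j‖ ≤ 𝓐) ∧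
      ∀ p B' : VecField (F.P Kt) k E3, ‖p‖ < R → ‖B'‖ < R → ∃ U' : GaugeField (F.P Kt) 0 SU2,
        (∀ b, Ũ (cplxVec p, cplxVec B') b = ((U' b : SU2) : Matrix (Fin 2) (Fin 2) ℂ)) ∧
          IsMinimizer (Node00.avOfRecord F 2 Kt) (Node00.regMSCoPOfRecord F 2 ν Kt k (maxDomT ν.M₁ Z)) (Bj ν.M₁ Z k)
            (avgFamily (Node00.avOfRecord F 2 Kt) (qsstarGIter0 k (expMul su2Chart B' (ext (expMul su2Chart p W))))) U') :
    ∃ Ũ : VecField (F.P Kt) k (EuclideanSpace ℂ (Fin 3)) × VecField (F.P Kt) k (EuclideanSpace ℂ (Fin 3)) → PBond (F.P Kt) 0 → Matrix (Fin 2) (Fin 2) ℂ,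
      (∀ b i j, DifferentiableOn ℂ (fun z => Ũ z b i j) (ball 0 (R / 3))) ∧
      (∀ z ∈ ball (0 : VecField (F.P Kt) k (EuclideanSpace ℂ (Fin 3)) × VecField (F.P Kt) k (EuclideanSpace ℂ (Fin 3))) (R / 3), ∀ b i j, ‖Ũ z b i j‖ ≤ 4 * 𝓐) ∧
      ∀ p B' : VecField (F.P Kt) k E3, ‖p‖ < R / 3 → ‖B'‖ < R / 3 → ∃ U' : GaugeField (F.P Kt) 0 SU2,
        (∀ b, Ũ (cplxVec p, cplxVec B') b = ((U' b : SU2) : Matrix (Fin 2) (Fin 2) ℂ)) ∧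
          IsMinimizer (Node00.avOfRecord F 2 Kt) (Node00.regMSCoPOfRecord F 2 ν Kt k (maxDomT ν.M₁ Z)) (Bj ν.M₁ Z k)
            (avgFamily (Node00.avOfRecord F 2 Kt) (qsstarGIter0 k (expMul su2Chart B' (ext (expMul su2Chart p (gaugeAct u W)))))) U' :=
  hMinBody_gaugeAct (Node00.avOfRecord F 2 Kt) (fun w U hU => gaugeAct_mem_regMSCoPOfRecord ν Kt k (maxDomT ν.M₁ Z) w U hU)
    (fun j hj => Bj_of_gt (lt_of_le_of_lt hk hj)) hk ext u
    (fun X => by rw [hext, hext, extend_gaugeAct_of_eq_one hN u X hu hu₀]) W h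

/-- The inverse gauge undoes the gauge: `(V^u)^{u⁻¹} = V`. [cite: Balaban1985Averaging, (8) p.18 (bookkeeping)] -/
theorem gaugeAct_invG_gaugeAct {P : Params} {j : ℕ} {G : Type*} [GaugeGroup G] (u : GaugeTransf P j G) (V : GaugeField P j G) :
    gaugeAct (invG u) (gaugeAct u V) = V := by
  funext b
  simp [gaugeAct, invG, mul_assoc]

/-- ★★★ **RETURN ALONG THE ORBIT** — the form the knit-side composition uses: if `ũ` is `1` on the box and at its corner (dag-n12-w6's normalising gauge
`exists_gauge_normalising_extend_shellGauged` has both) and the `hMin`-body holds at the NORMALISED representative `V^{ũ}` with `(R, 𝓐)`, then it holds at `V` itself with `(R∕3, 4𝓐)`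
(§4 at `u := ũ⁻¹`, `W := V^{ũ}`). [cite: Balaban1989LargeFieldI, p.194 (sentence after (1.77)); Balaban1989LargeFieldII, p.357, p.358; Balaban1985Variational, (181) p.307] -/
theorem hMinBody_of_gaugeAct_normalised {F : T4Family} (ν : Node00.Stage7Numerics) (Kt : ℕ) {k : ℕ} (hk : k ≤ (F.P Kt).m + (F.P Kt).K)
    (Z : Set (Site (F.P Kt) 0)) {lo hi : Fin (F.P Kt).d → ℤ} (hN : ∀ κ, hi κ - lo κ + 3 < ((F.P Kt).sitesPerDir k : ℤ))
    (ext : GaugeField (F.P Kt) k SU2 → GaugeField (F.P Kt) k SU2)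
    (hext : ∀ V, ext V = extend (castSite '' Set.Icc lo hi : Set (Site (F.P Kt) k)) (shellGauge V lo hi) V)
    (ũ : GaugeTransf (F.P Kt) k SU2) (hu : ∀ s ∈ (castSite '' Set.Icc lo hi : Set (Site (F.P Kt) k)), ũ s = 1) (hu₀ : ũ (castSite (lo - 1)) = 1)
    (V : GaugeField (F.P Kt) k SU2) {R 𝓐 : ℝ}
    (h : ∃ Ũ : VecField (F.P Kt) k (EuclideanSpace ℂ (Fin 3)) × VecField (F.P Kt) k (EuclideanSpace ℂ (Fin 3)) → PBond (F.P Kt) 0 → Matrix (Fin 2) (Fin 2) ℂ,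
      (∀ b i j, DifferentiableOn ℂ (fun z => Ũ z b i j) (ball 0 R)) ∧
      (∀ z ∈ ball (0 : VecField (F.P Kt) k (EuclideanSpace ℂ (Fin 3)) × VecField (F.P Kt) k (EuclideanSpace ℂ (Fin 3))) R, ∀ b i j, ‖Ũ z b i j‖ ≤ 𝓐) ∧
      ∀ p B' : VecField (F.P Kt) k E3, ‖p‖ < R → ‖B'‖ < R → ∃ U' : GaugeField (F.P Kt) 0 SU2,
        (∀ b, Ũ (cplxVec p, cplxVec B') b = ((U' b : SU2) : Matrix (Fin 2) (Fin 2) ℂ)) ∧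
          IsMinimizer (Node00.avOfRecord F 2 Kt) (Node00.regMSCoPOfRecord F 2 ν Kt k (maxDomT ν.M₁ Z)) (Bj ν.M₁ Z k)
            (avgFamily (Node00.avOfRecord F 2 Kt) (qsstarGIter0 k (expMul su2Chart B' (ext (expMul su2Chart p (gaugeAct ũ V)))))) U') :
    ∃ Ũ : VecField (F.P Kt) k (EuclideanSpace ℂ (Fin 3)) × VecField (F.P Kt) k (EuclideanSpace ℂ (Fin 3)) → PBond (F.P Kt) 0 → Matrix (Fin 2) (Fin 2) ℂ,
      (∀ b i j, DifferentiableOn ℂ (fun z => Ũ z b i j) (ball 0 (R / 3))) ∧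
      (∀ z ∈ ball (0 : VecField (F.P Kt) k (EuclideanSpace ℂ (Fin 3)) × VecField (F.P Kt) k (EuclideanSpace ℂ (Fin 3))) (R / 3), ∀ b i j, ‖Ũ z b i j‖ ≤ 4 * 𝓐) ∧
      ∀ p B' : VecField (F.P Kt) k E3, ‖p‖ < R / 3 → ‖B'‖ < R / 3 → ∃ U' : GaugeField (F.P Kt) 0 SU2,
        (∀ b, Ũ (cplxVec p, cplxVec B') b = ((U' b : SU2) : Matrix (Fin 2) (Fin 2) ℂ)) ∧
          IsMinimizer (Node00.avOfRecord F 2 Kt) (Node00.regMSCoPOfRecord F 2 ν Kt k (maxDomT ν.M₁ Z)) (Bj ν.M₁ Z k)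
            (avgFamily (Node00.avOfRecord F 2 Kt) (qsstarGIter0 k (expMul su2Chart B' (ext (expMul su2Chart p V))))) U' := by
  have h' := hMinBody_gaugeAct_atRecord ν Kt hk Z hN ext hext (invG ũ) (fun s hs => by simp [invG, hu s hs]) (by rw [invG, hu₀, inv_one]) (gaugeAct ũ V) h
  rw [gaugeAct_invG_gaugeAct] at h'
  exact h'

end AtRecord

/-! ## §5  The certificate of LOCATED-GAUGE-ORBIT: pure gauges lie in every guard, and a datum letter asked of all of them forces its tolerance above every `dist1 h` -/

section Certificate

variable {P : Params} {k : ℕ} {G : Type*} [GaugeGroup G]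

/-- A pure gauge `1^g` reads `g(b₋)·g(b₊)⁻¹` on every bond. [cite: Balaban1985Averaging, (8) p.19 (bookkeeping)] -/
theorem gaugeAct_one_apply (g : GaugeTransf P k G) (c : PBond P k) : gaugeAct g (1 : GaugeField P k G) c = g c.src * (g c.tgt)⁻¹ := by
  show g c.src * 1 * (g c.tgt)⁻¹ = g c.src * (g c.tgt)⁻¹
  rw [mul_one]

/-- **PURE GAUGES LIE IN EVERY PLAQUETTE GUARD**: `1^g` is `ε`-small on any plaquette set for any `ε > 0` (the guard is gauge invariant and `1` is flat). [cite: Balaban1989LargeFieldI, (1.78) p.194 (the plaquette deviation is an orbit invariant)] -/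
theorem plaqSmallOn_gaugeAct_one (g : GaugeTransf P k G) (S : Set (Plaq P k)) {ε : ℝ} (hε : 0 < ε) :
    PlaqSmallOn S ε (gaugeAct g (1 : GaugeField P k G)) := fun p _ => by
  rw [B15Prop1Carrier.dist1_plaqHol_gaugeAct, B15Chi124DetSets.plaqHol_one, GaugeGroup.dist1_one]
  exact hε

/-- ★ **A DATUM LETTER ASKED OF EVERY PURE GAUGE FORCES ITS TOLERANCE ABOVE THE DIAMETER** (the kernel form of the lane's LOCATED-GAUGE-ORBIT): if a bond `c` (with distinct ends) is
not touched by the extension on pure gauges (`ext (1^g) c = (1^g) c` — print's p. 193 extension off the box) and the datum letter `dist1 ((ext V) c) ≤ ρn` is asked of EVERY pure gauge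
`V = 1^g` (all of which lie in every plaquette guard, `plaqSmallOn_gaugeAct_one`), then `dist1 h ≤ ρn` for EVERY group element `h` (take `g := 1` except `g(c₊) := h⁻¹`) — on `SU(2)`,
`h = −1` gives `ρn ≥ 2`.  So the per-base-field datum ∕ gauge rows cannot be asked of every base field of a gauge-invariant guard; they are asked of a normalised representative and
transported by §3–§4. [cite: Balaban1989LargeFieldI, p.194 (sentence after (1.77)); Balaban1985Averaging, (8) p.19] -/
theorem dist1_le_of_forall_pureGauge_datumLetter (c : PBond P k) (hc : c.src ≠ c.tgt) {ρn : ℝ} (ext : GaugeField P k G → GaugeField P k G)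
    (hext : ∀ g : GaugeTransf P k G, ext (gaugeAct g 1) c = gaugeAct g 1 c)
    (hletter : ∀ g : GaugeTransf P k G, dist1 (ext (gaugeAct g 1) c) ≤ ρn) (h : G) : dist1 h ≤ ρn := by
  classical
  have key := hletter (Function.update (fun _ => (1 : G)) c.tgt h⁻¹)
  rw [hext, gaugeAct_one_apply, Function.update_of_ne hc, Function.update_self, inv_inv, one_mul] at key
  exact key

end Certificate

end Literature.MathematicalPhysics.QuantumFieldTheory.Balaban1983to89.B15Prop1MinimiserFamilyGaugeCovariance

end
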